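import Literature.Dynamics.NBody.AlbouyKaloshin2012SymmetricSlices

/-!
# Sign branches of the `E32` mirror slices `T12` / `T1234`

Topic `Literature/Dynamics/NBody`; companion of `AlbouyKaloshin2012SymmetricSlices.lean` (the slice
systems `T12Slice`, `T1234Slice` ⇔ system (4) of [AlbouyKaloshin2012] on the mirror-symmetric
subspaces of the exceptional component `E32 = {m₁ = m₂, m₃ = m₄}`).

In `T12` the bodies 3, 4, 5 are collinear and 1, 2 are a mirror pair, so four of the seven
inverse-distance relations are squares of LINEAR-in-`δ` products:
`u²(4s²) = (u·2s)²`, `d₃₄²(y₄−y₃)² = (d₃₄(y₄−y₃))²`, `d₃₅²(y₅−y₃)²`, `d₄₅²(y₅−y₄)²`.  Hence the real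
(indeed, over any field) solution set of `T12Slice b c` is the disjoint union over
`σ = (σ₁₂,σ₃₄,σ₃₅,σ₄₅) ∈ {±1}⁴` of the BRANCH systems `T12Branch σ b c` in which those four degree-4
equations are replaced by the degree-2 equations `u·2s = σ₁₂`, `d₃₄(y₄−y₃) = σ₃₄`, … .  Three
involutions of the coordinate space permute the branches — `s ↦ −s` (relabel 1↔2), the reflection of the
axis coordinate (`t, y_k ↦ −t, −y_k`), and the relabelling 3↔4 (legitimate because `m₃ = m₄ = b`) — and
leave three classes, represented by `σ = (1,1,1,1), (1,1,1,−1), (1,1,−1,1)`.  Consequently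
(`t12SliceSet_finite_iff_three`) the slice has finitely many solutions iff these THREE branch systems do;
for `T1234` (two mirror pairs) ONE branch suffices (`t1234SliceSet_finite_iff_one`).  The signed,
`2^{1/3}`-rescaled Roberts continuum of `t12Slice_roberts` lies in the branch `(1,−1,1,−1)`, so the
representative branch `(1,1,−1,1)` of `T12(1, 1/4)` is infinite (`t12BranchSet_one_quarter_infinite`):
the calibration instance for branch computations.

This is the bookkeeping behind the cell's branch-wise Gröbner computations
(`run/shared/lean/pub/pub-smale6/code/modgb`, case modifier `:br=`): a dimension statement for the slice
at a mass point is the conjunction of the statements for three (resp. one) branch systems of half the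
degree in four (resp. two) of the equations.  Elementary algebra only; no claim about any particular
mass point other than `(1, 1/4)` is made here.
-/

namespace Literature.Dynamics.NBody

/-- A point of the `T12` coordinate space (the twelve unknowns of `T12Slice`). [folklore] -/
structure T12Pt where
  (s t y₃ y₄ y₅ u p₃ p₄ p₅ d₃₄ d₃₅ d₄₅ : ℝ)

/-- `T12Slice` evaluated at a point. [folklore] -/
def T12Pt.Slice (b c : ℝ) (X : T12Pt) : Prop :=
  T12Slice b c X.s X.t X.y₃ X.y₄ X.y₅ X.u X.p₃ X.p₄ X.p₅ X.d₃₄ X.d₃₅ X.d₄₅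

/-- The branch system `T12_σ`: `T12Slice` with `D12, D34, D35, D45` replaced by the sign equations
`u·2s = σ₁₂`, `d₃₄(y₄−y₃) = σ₃₄`, `d₃₅(y₅−y₃) = σ₃₅`, `d₄₅(y₅−y₄) = σ₄₅`. [folklore] -/
def T12Branch (σ₁₂ σ₃₄ σ₃₅ σ₄₅ b c : ℝ) (X : T12Pt) : Prop :=
  X.t - (b * X.p₃ ^ 3 * (X.t - X.y₃) + b * X.p₄ ^ 3 * (X.t - X.y₄) + c * X.p₅ ^ 3 * (X.t - X.y₅)) = 0 ∧
  X.s - (2 * X.u ^ 3 * X.s + b * X.p₃ ^ 3 * X.s + b * X.p₄ ^ 3 * X.s + c * X.p₅ ^ 3 * X.s) = 0 ∧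
  X.y₃ - (2 * X.p₃ ^ 3 * (X.y₃ - X.t) + b * X.d₃₄ ^ 3 * (X.y₃ - X.y₄) + c * X.d₃₅ ^ 3 * (X.y₃ - X.y₅)) = 0 ∧
  X.y₄ - (2 * X.p₄ ^ 3 * (X.y₄ - X.t) + b * X.d₃₄ ^ 3 * (X.y₄ - X.y₃) + c * X.d₄₅ ^ 3 * (X.y₄ - X.y₅)) = 0 ∧
  X.y₅ - (2 * X.p₅ ^ 3 * (X.y₅ - X.t) + b * X.d₃₅ ^ 3 * (X.y₅ - X.y₃) + b * X.d₄₅ ^ 3 * (X.y₅ - X.y₄)) = 0 ∧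
  X.u * (2 * X.s) = σ₁₂ ∧
  X.p₃ ^ 2 * ((X.y₃ - X.t) ^ 2 + X.s ^ 2) - 1 = 0 ∧
  X.p₄ ^ 2 * ((X.y₄ - X.t) ^ 2 + X.s ^ 2) - 1 = 0 ∧
  X.p₅ ^ 2 * ((X.y₅ - X.t) ^ 2 + X.s ^ 2) - 1 = 0 ∧
  X.d₃₄ * (X.y₄ - X.y₃) = σ₃₄ ∧
  X.d₃₅ * (X.y₅ - X.y₃) = σ₃₅ ∧
  X.d₄₅ * (X.y₅ - X.y₄) = σ₄₅

/-- `σ` is a sign. [folklore] -/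
def IsSign (σ : ℝ) : Prop := σ = 1 ∨ σ = -1

/-- `a·a − 1 = 0 ↔ a = ±1`. [folklore] -/
theorem sq_rel_iff (a : ℝ) : a * a - 1 = 0 ↔ IsSign a := by
  rw [sub_eq_zero]; exact mul_self_eq_one_iff

/-- **Branch cover.** A point solves `T12Slice b c` iff it solves some branch system `T12_σ` with
`σ ∈ {±1}⁴` (and then `σ` is the tuple of the four products). [folklore] -/
theorem t12Slice_iff_exists_branch (b c : ℝ) (X : T12Pt) :
    X.Slice b c ↔ ∃ σ₁₂ σ₃₄ σ₃₅ σ₄₅ : ℝ, IsSign σ₁₂ ∧ IsSign σ₃₄ ∧ IsSign σ₃₅ ∧ IsSign σ₄₅ ∧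
      T12Branch σ₁₂ σ₃₄ σ₃₅ σ₄₅ b c X := by
  constructor
  · rintro ⟨h1, h2, h3, h4, h5, h6, h7, h8, h9, h10, h11, h12⟩
    refine ⟨X.u * (2 * X.s), X.d₃₄ * (X.y₄ - X.y₃), X.d₃₅ * (X.y₅ - X.y₃), X.d₄₅ * (X.y₅ - X.y₄),
      ?_, ?_, ?_, ?_, h1, h2, h3, h4, h5, rfl, h7, h8, h9, rfl, rfl, rfl⟩
    · exact (sq_rel_iff _).1 (by linear_combination h6)
    · exact (sq_rel_iff _).1 (by linear_combination h10)
    · exact (sq_rel_iff _).1 (by linear_combination h11)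
    · exact (sq_rel_iff _).1 (by linear_combination h12)
  · rintro ⟨σ₁₂, σ₃₄, σ₃₅, σ₄₅, s12, s34, s35, s45, h1, h2, h3, h4, h5, h6, h7, h8, h9, h10, h11, h12⟩
    have e12 := (mul_self_eq_one_iff.mpr s12); have e34 := (mul_self_eq_one_iff.mpr s34)
    have e35 := (mul_self_eq_one_iff.mpr s35); have e45 := (mul_self_eq_one_iff.mpr s45)
    refine ⟨h1, h2, h3, h4, h5, ?_, h7, h8, h9, ?_, ?_, ?_⟩
    · rw [← h6] at e12; linear_combination e12
    · rw [← h10] at e34; linear_combination e34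
    · rw [← h11] at e35; linear_combination e35
    · rw [← h12] at e45; linear_combination e45

/-- Relabel 1↔2: `s ↦ −s`. [folklore] -/
def T12Pt.negS (X : T12Pt) : T12Pt := { X with s := -X.s }

/-- Reflect the axis coordinate: `t, y₃, y₄, y₅ ↦ −t, −y₃, −y₄, −y₅`. [folklore] -/
def T12Pt.reflect (X : T12Pt) : T12Pt := { X with t := -X.t, y₃ := -X.y₃, y₄ := -X.y₄, y₅ := -X.y₅ }

/-- Relabel 3↔4 (masses `m₃ = m₄ = b`): swap `y₃,y₄`, `p₃,p₄`, `d₃₅,d₄₅`. [folklore] -/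
def T12Pt.swap34 (X : T12Pt) : T12Pt :=
  { X with y₃ := X.y₄, y₄ := X.y₃, p₃ := X.p₄, p₄ := X.p₃, d₃₅ := X.d₄₅, d₄₅ := X.d₃₅ }

/-- `negS` is an involution. [folklore] -/
@[simp] theorem T12Pt.negS_negS (X : T12Pt) : X.negS.negS = X := by
  cases X; simp [T12Pt.negS]
/-- `reflect` is an involution. [folklore] -/
@[simp] theorem T12Pt.reflect_reflect (X : T12Pt) : X.reflect.reflect = X := by
  cases X; simp [T12Pt.reflect]
/-- `swap34` is an involution. [folklore] -/
@[simp] theorem T12Pt.swap34_swap34 (X : T12Pt) : X.swap34.swap34 = X := by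
  cases X; simp [T12Pt.swap34]

/-- `s ↦ −s` maps branch `σ` to branch `(−σ₁₂, σ₃₄, σ₃₅, σ₄₅)`. [folklore] -/
theorem T12Branch.negS {σ₁₂ σ₃₄ σ₃₅ σ₄₅ b c : ℝ} {X : T12Pt} (h : T12Branch σ₁₂ σ₃₄ σ₃₅ σ₄₅ b c X) :
    T12Branch (-σ₁₂) σ₃₄ σ₃₅ σ₄₅ b c X.negS := by
  obtain ⟨h1, h2, h3, h4, h5, h6, h7, h8, h9, h10, h11, h12⟩ := h
  simp only [T12Branch, T12Pt.negS]
  exact ⟨h1, by linear_combination -h2, h3, h4, h5, by linear_combination -h6,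
    by linear_combination h7, by linear_combination h8, by linear_combination h9, h10, h11, h12⟩

/-- The axis reflection maps branch `σ` to branch `(σ₁₂, −σ₃₄, −σ₃₅, −σ₄₅)`. [folklore] -/
theorem T12Branch.reflect {σ₁₂ σ₃₄ σ₃₅ σ₄₅ b c : ℝ} {X : T12Pt} (h : T12Branch σ₁₂ σ₃₄ σ₃₅ σ₄₅ b c X) :
    T12Branch σ₁₂ (-σ₃₄) (-σ₃₅) (-σ₄₅) b c X.reflect := by
  obtain ⟨h1, h2, h3, h4, h5, h6, h7, h8, h9, h10, h11, h12⟩ := h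
  simp only [T12Branch, T12Pt.reflect]
  exact ⟨by linear_combination -h1, h2, by linear_combination -h3, by linear_combination -h4,
    by linear_combination -h5, h6, by linear_combination h7, by linear_combination h8,
    by linear_combination h9, by linear_combination -h10, by linear_combination -h11,
    by linear_combination -h12⟩

/-- The relabelling 3↔4 maps branch `σ` to branch `(σ₁₂, −σ₃₄, σ₄₅, σ₃₅)`. [folklore] -/
theorem T12Branch.swap34 {σ₁₂ σ₃₄ σ₃₅ σ₄₅ b c : ℝ} {X : T12Pt} (h : T12Branch σ₁₂ σ₃₄ σ₃₅ σ₄₅ b c X) :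
    T12Branch σ₁₂ (-σ₃₄) σ₄₅ σ₃₅ b c X.swap34 := by
  obtain ⟨h1, h2, h3, h4, h5, h6, h7, h8, h9, h10, h11, h12⟩ := h
  simp only [T12Branch, T12Pt.swap34]
  exact ⟨by linear_combination h1, by linear_combination h2, by linear_combination h4,
    by linear_combination h3, by linear_combination h5, h6, h8, h7, h9, by linear_combination -h10,
    h12, h11⟩

/-- Solution set of the slice. [folklore] -/
def t12SliceSet (b c : ℝ) : Set T12Pt := {X | X.Slice b c}

/-- Solution set of the branch system `T12_σ`. [folklore] -/
def t12BranchSet (σ₁₂ σ₃₄ σ₃₅ σ₄₅ b c : ℝ) : Set T12Pt := {X | T12Branch σ₁₂ σ₃₄ σ₃₅ σ₄₅ b c X}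

/-- Every branch solution is a slice solution. [folklore] -/
theorem t12BranchSet_subset_slice {σ₁₂ σ₃₄ σ₃₅ σ₄₅ : ℝ} (s12 : IsSign σ₁₂) (s34 : IsSign σ₃₄)
    (s35 : IsSign σ₃₅) (s45 : IsSign σ₄₅) (b c : ℝ) :
    t12BranchSet σ₁₂ σ₃₄ σ₃₅ σ₄₅ b c ⊆ t12SliceSet b c := fun X hX =>
  (t12Slice_iff_exists_branch b c X).2 ⟨σ₁₂, σ₃₄, σ₃₅, σ₄₅, s12, s34, s35, s45, hX⟩

/-- The sixteen sign tuples. [folklore] -/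
noncomputable def signs4 : Finset (ℝ × ℝ × ℝ × ℝ) := ({1, -1} : Finset ℝ) ×ˢ ({1, -1} : Finset ℝ) ×ˢ
  ({1, -1} : Finset ℝ) ×ˢ ({1, -1} : Finset ℝ)

/-- The slice solution set is covered by the sixteen branch sets. [folklore] -/
theorem t12SliceSet_subset_iUnion (b c : ℝ) :
    t12SliceSet b c ⊆ ⋃ σ ∈ signs4, t12BranchSet σ.1 σ.2.1 σ.2.2.1 σ.2.2.2 b c := by
  intro X hX
  obtain ⟨σ₁₂, σ₃₄, σ₃₅, σ₄₅, s12, s34, s35, s45, hB⟩ := (t12Slice_iff_exists_branch b c X).1 hX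
  simp only [Set.mem_iUnion]
  refine ⟨(σ₁₂, σ₃₄, σ₃₅, σ₄₅), ?_, hB⟩
  rcases s12 with rfl | rfl <;> rcases s34 with rfl | rfl <;> rcases s35 with rfl | rfl <;>
    rcases s45 with rfl | rfl <;> simp [signs4]

/-- **Finiteness of the slice is finiteness of all sixteen branches.** [folklore] -/
theorem t12SliceSet_finite_iff (b c : ℝ) :
    (t12SliceSet b c).Finite ↔ ∀ σ₁₂ σ₃₄ σ₃₅ σ₄₅ : ℝ, IsSign σ₁₂ → IsSign σ₃₄ → IsSign σ₃₅ →
      IsSign σ₄₅ → (t12BranchSet σ₁₂ σ₃₄ σ₃₅ σ₄₅ b c).Finite := by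
  constructor
  · intro h σ₁₂ σ₃₄ σ₃₅ σ₄₅ s12 s34 s35 s45
    exact h.subset (t12BranchSet_subset_slice s12 s34 s35 s45 b c)
  · intro h
    refine Set.Finite.subset ?_ (t12SliceSet_subset_iUnion b c)
    refine Set.Finite.biUnion (signs4.finite_toSet) ?_
    intro σ hσ
    have hs : IsSign σ.1 ∧ IsSign σ.2.1 ∧ IsSign σ.2.2.1 ∧ IsSign σ.2.2.2 := by
      simp only [signs4, Finset.coe_product, Set.mem_prod, Finset.coe_insert, Finset.coe_singleton,
        Set.mem_insert_iff, Set.mem_singleton_iff] at hσ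
      exact ⟨hσ.1, hσ.2.1, hσ.2.2.1, hσ.2.2.2⟩
    exact h _ _ _ _ hs.1 hs.2.1 hs.2.2.1 hs.2.2.2

/-- Finiteness transfers along `s ↦ −s`. [folklore] -/
theorem t12BranchSet_finite_negS {σ₁₂ σ₃₄ σ₃₅ σ₄₅ b c : ℝ}
    (h : (t12BranchSet σ₁₂ σ₃₄ σ₃₅ σ₄₅ b c).Finite) : (t12BranchSet (-σ₁₂) σ₃₄ σ₃₅ σ₄₅ b c).Finite := by
  refine (h.image T12Pt.negS).subset ?_
  intro X hX
  refine ⟨X.negS, ?_, X.negS_negS⟩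
  have := T12Branch.negS (σ₁₂ := -σ₁₂) hX
  simpa [t12BranchSet] using this

/-- Finiteness transfers along the axis reflection. [folklore] -/
theorem t12BranchSet_finite_reflect {σ₁₂ σ₃₄ σ₃₅ σ₄₅ b c : ℝ}
    (h : (t12BranchSet σ₁₂ σ₃₄ σ₃₅ σ₄₅ b c).Finite) :
    (t12BranchSet σ₁₂ (-σ₃₄) (-σ₃₅) (-σ₄₅) b c).Finite := by
  refine (h.image T12Pt.reflect).subset ?_
  intro X hX
  refine ⟨X.reflect, ?_, X.reflect_reflect⟩
  have := T12Branch.reflect (σ₃₄ := -σ₃₄) (σ₃₅ := -σ₃₅) (σ₄₅ := -σ₄₅) hX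
  simpa [t12BranchSet] using this

/-- Finiteness transfers along the relabelling 3↔4. [folklore] -/
theorem t12BranchSet_finite_swap34 {σ₁₂ σ₃₄ σ₃₅ σ₄₅ b c : ℝ}
    (h : (t12BranchSet σ₁₂ σ₃₄ σ₃₅ σ₄₅ b c).Finite) :
    (t12BranchSet σ₁₂ (-σ₃₄) σ₄₅ σ₃₅ b c).Finite := by
  refine (h.image T12Pt.swap34).subset ?_
  intro X hX
  refine ⟨X.swap34, ?_, X.swap34_swap34⟩
  have := T12Branch.swap34 (σ₃₄ := -σ₃₄) (σ₃₅ := σ₄₅) (σ₄₅ := σ₃₅) hX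
  simpa [t12BranchSet] using this

/-- **Three branches decide the `T12` slice.** `T12Slice b c` has finitely many real solutions iff the
branch systems `σ = (1,1,1,1)`, `(1,1,1,−1)` and `(1,1,−1,1)` do. [folklore] -/
theorem t12SliceSet_finite_iff_three (b c : ℝ) :
    (t12SliceSet b c).Finite ↔ (t12BranchSet 1 1 1 1 b c).Finite ∧
      (t12BranchSet 1 1 1 (-1) b c).Finite ∧ (t12BranchSet 1 1 (-1) 1 b c).Finite := by
  rw [t12SliceSet_finite_iff]
  constructor
  · intro h
    exact ⟨h 1 1 1 1 (Or.inl rfl) (Or.inl rfl) (Or.inl rfl) (Or.inl rfl),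
      h 1 1 1 (-1) (Or.inl rfl) (Or.inl rfl) (Or.inl rfl) (Or.inr rfl),
      h 1 1 (-1) 1 (Or.inl rfl) (Or.inl rfl) (Or.inr rfl) (Or.inl rfl)⟩
  · rintro ⟨hA, hB, hC⟩ σ₁₂ σ₃₄ σ₃₅ σ₄₅ s12 s34 s35 s45
    have hD := t12BranchSet_finite_reflect hA   -- (1,-1,-1,-1)
    have hE := t12BranchSet_finite_reflect hB   -- (1,-1,-1,1)
    have hF := t12BranchSet_finite_reflect hC   -- (1,-1,1,-1)
    have hG := t12BranchSet_finite_swap34 hA    -- (1,-1,1,1)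
    have hH := t12BranchSet_finite_reflect hG   -- (1,1,-1,-1)
    norm_num at hD hE hF hG hH
    rcases s12 with rfl | rfl
    · rcases s34 with rfl | rfl <;> rcases s35 with rfl | rfl <;> rcases s45 with rfl | rfl
      all_goals assumption
    · have nA := t12BranchSet_finite_negS hA; have nB := t12BranchSet_finite_negS hB
      have nC := t12BranchSet_finite_negS hC; have nD := t12BranchSet_finite_negS hD
      have nE := t12BranchSet_finite_negS hE; have nF := t12BranchSet_finite_negS hF
      have nG := t12BranchSet_finite_negS hG; have nH := t12BranchSet_finite_negS hH
      rcases s34 with rfl | rfl <;> rcases s35 with rfl | rfl <;> rcases s45 with rfl | rfl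
      all_goals assumption

/-- The signed `2^{1/3}`-rescaled Roberts points of `t12Slice_roberts` lie in the branch
`σ = (1, −1, 1, −1)`. [cite: AlbouyKaloshin2012, Remark 8 p. 583] -/
theorem t12Branch_roberts (a b' : ℝ) (ha : a ≠ 0) (hb : b' ≠ 0) (hab : a ^ 2 + b' ^ 2 = 1) :
    T12Branch 1 (-1) 1 (-1) 1 (1 / 4)
      ⟨cbrtTwo * a, 0, cbrtTwo * b', -(cbrtTwo * b'), 0, 1 / (2 * cbrtTwo * a), 1 / cbrtTwo, 1 / cbrtTwo,
        -1 / (cbrtTwo * a), 1 / (2 * cbrtTwo * b'), -1 / (cbrtTwo * b'), -1 / (cbrtTwo * b')⟩ := by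
  have hS : T12Pt.Slice 1 (1 / 4) ⟨cbrtTwo * a, 0, cbrtTwo * b', -(cbrtTwo * b'), 0, 1 / (2 * cbrtTwo * a),
      1 / cbrtTwo, 1 / cbrtTwo, -1 / (cbrtTwo * a), 1 / (2 * cbrtTwo * b'), -1 / (cbrtTwo * b'),
      -1 / (cbrtTwo * b')⟩ := t12Slice_roberts a b' ha hb hab
  obtain ⟨h1, h2, h3, h4, h5, -, h7, h8, h9, -, -, -⟩ := hS
  have hμ := cbrtTwo_pos.ne'
  refine ⟨h1, h2, h3, h4, h5, ?_, h7, h8, h9, ?_, ?_, ?_⟩ <;> field_simp <;> ring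

/-- Hence the representative branch `(1,1,−1,1)` of `T12(1, 1/4)` — the axis reflection of the Roberts
branch — has infinitely many real solutions: the calibration instance of the branch computations.
[cite: AlbouyKaloshin2012, Remark 8 p. 583] -/
theorem t12BranchSet_one_quarter_infinite : (t12BranchSet 1 1 (-1) 1 1 (1 / 4)).Infinite := by
  intro hfin
  have h := t12BranchSet_finite_reflect hfin
  norm_num at h
  -- `h : (t12BranchSet 1 (-1) 1 (-1) 1 (1/4)).Finite`; project to the coordinate `s`
  have hinj : Set.InjOn (fun a : ℝ => cbrtTwo * a) (Set.Ioo (0 : ℝ) 1) := by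
    intro a _ a' _ h
    have hμ0 := cbrtTwo_pos.ne'
    simpa [mul_right_inj' hμ0] using h
  have hsub : (fun a : ℝ => cbrtTwo * a) '' Set.Ioo (0 : ℝ) 1 ⊆ T12Pt.s '' t12BranchSet 1 (-1) 1 (-1) 1 (1 / 4) := by
    rintro _ ⟨a, ⟨ha0, ha1⟩, rfl⟩
    have hpos : 0 < 1 - a ^ 2 := by nlinarith
    set b' := Real.sqrt (1 - a ^ 2) with hb'
    have hb0 : b' ≠ 0 := (Real.sqrt_pos.mpr hpos).ne'
    have hab : a ^ 2 + b' ^ 2 = 1 := by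
      rw [hb', Real.sq_sqrt hpos.le]; ring
    exact ⟨_, t12Branch_roberts a b' ha0.ne' hb0 hab, rfl⟩
  exact ((Set.Ioo_infinite (by norm_num : (0 : ℝ) < 1)).image hinj).mono hsub |>.not_finite
    (h.image T12Pt.s) |>.elim
  
/-! ## `T1234`: one branch suffices -/

/-- A point of the `T1234` coordinate space. [folklore] -/
structure T1234Pt where
  (a₁ t₁ a₃ t₃ t₅ u v p r e f : ℝ)

/-- `T1234Slice` evaluated at a point. [folklore] -/
def T1234Pt.Slice (b c : ℝ) (X : T1234Pt) : Prop :=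
  T1234Slice b c X.a₁ X.t₁ X.a₃ X.t₃ X.t₅ X.u X.v X.p X.r X.e X.f

/-- Branch system of `T1234`: `D12`, `D34` replaced by `u·2a₁ = σ₁₂`, `v·2a₃ = σ₃₄`. [folklore] -/
def T1234Branch (σ₁₂ σ₃₄ b c : ℝ) (X : T1234Pt) : Prop :=
  X.t₁ - (b * X.p ^ 3 * (X.t₁ - X.t₃) + b * X.r ^ 3 * (X.t₁ - X.t₃) + c * X.e ^ 3 * (X.t₁ - X.t₅)) = 0 ∧
  X.a₁ - (2 * X.u ^ 3 * X.a₁ + b * X.p ^ 3 * (X.a₁ - X.a₃) + b * X.r ^ 3 * (X.a₁ + X.a₃) + c * X.e ^ 3 * X.a₁) = 0 ∧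
  X.t₃ - (X.p ^ 3 * (X.t₃ - X.t₁) + X.r ^ 3 * (X.t₃ - X.t₁) + c * X.f ^ 3 * (X.t₃ - X.t₅)) = 0 ∧
  X.a₃ - (X.p ^ 3 * (X.a₃ - X.a₁) + X.r ^ 3 * (X.a₃ + X.a₁) + 2 * b * X.v ^ 3 * X.a₃ + c * X.f ^ 3 * X.a₃) = 0 ∧
  X.t₅ - (2 * X.e ^ 3 * (X.t₅ - X.t₁) + 2 * b * X.f ^ 3 * (X.t₅ - X.t₃)) = 0 ∧
  X.u * (2 * X.a₁) = σ₁₂ ∧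
  X.v * (2 * X.a₃) = σ₃₄ ∧
  X.p ^ 2 * ((X.t₃ - X.t₁) ^ 2 + (X.a₃ - X.a₁) ^ 2) - 1 = 0 ∧
  X.r ^ 2 * ((X.t₃ - X.t₁) ^ 2 + (X.a₃ + X.a₁) ^ 2) - 1 = 0 ∧
  X.e ^ 2 * ((X.t₅ - X.t₁) ^ 2 + X.a₁ ^ 2) - 1 = 0 ∧
  X.f ^ 2 * ((X.t₅ - X.t₃) ^ 2 + X.a₃ ^ 2) - 1 = 0

/-- **Branch cover for `T1234`.** [folklore] -/
theorem t1234Slice_iff_exists_branch (b c : ℝ) (X : T1234Pt) :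
    X.Slice b c ↔ ∃ σ₁₂ σ₃₄ : ℝ, IsSign σ₁₂ ∧ IsSign σ₃₄ ∧ T1234Branch σ₁₂ σ₃₄ b c X := by
  constructor
  · rintro ⟨h1, h2, h3, h4, h5, h6, h7, h8, h9, h10, h11⟩
    refine ⟨X.u * (2 * X.a₁), X.v * (2 * X.a₃), ?_, ?_, h1, h2, h3, h4, h5, rfl, rfl, h8, h9, h10, h11⟩
    · exact (sq_rel_iff _).1 (by linear_combination h6)
    · exact (sq_rel_iff _).1 (by linear_combination h7)
  · rintro ⟨σ₁₂, σ₃₄, s12, s34, h1, h2, h3, h4, h5, h6, h7, h8, h9, h10, h11⟩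
    have e12 := (mul_self_eq_one_iff.mpr s12); have e34 := (mul_self_eq_one_iff.mpr s34)
    refine ⟨h1, h2, h3, h4, h5, ?_, ?_, h8, h9, h10, h11⟩
    · rw [← h6] at e12; linear_combination e12
    · rw [← h7] at e34; linear_combination e34

/-- Relabel 1↔2: `a₁ ↦ −a₁`, `p ↔ r`. [folklore] -/
def T1234Pt.neg1 (X : T1234Pt) : T1234Pt := { X with a₁ := -X.a₁, p := X.r, r := X.p }

/-- Relabel 3↔4: `a₃ ↦ −a₃`, `p ↔ r`. [folklore] -/
def T1234Pt.neg3 (X : T1234Pt) : T1234Pt := { X with a₃ := -X.a₃, p := X.r, r := X.p }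

/-- `neg1` is an involution. [folklore] -/
@[simp] theorem T1234Pt.neg1_neg1 (X : T1234Pt) : X.neg1.neg1 = X := by
  cases X; simp [T1234Pt.neg1]
/-- `neg3` is an involution. [folklore] -/
@[simp] theorem T1234Pt.neg3_neg3 (X : T1234Pt) : X.neg3.neg3 = X := by
  cases X; simp [T1234Pt.neg3]

/-- Relabel 1↔2 maps branch `σ` to `(−σ₁₂, σ₃₄)`. [folklore] -/
theorem T1234Branch.neg1 {σ₁₂ σ₃₄ b c : ℝ} {X : T1234Pt} (h : T1234Branch σ₁₂ σ₃₄ b c X) :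
    T1234Branch (-σ₁₂) σ₃₄ b c X.neg1 := by
  obtain ⟨h1, h2, h3, h4, h5, h6, h7, h8, h9, h10, h11⟩ := h
  simp only [T1234Branch, T1234Pt.neg1]
  exact ⟨by linear_combination h1, by linear_combination -h2, by linear_combination h3,
    by linear_combination h4, h5, by linear_combination -h6, h7, by linear_combination h9,
    by linear_combination h8, by linear_combination h10, h11⟩

/-- Relabel 3↔4 maps branch `σ` to `(σ₁₂, −σ₃₄)`. [folklore] -/
theorem T1234Branch.neg3 {σ₁₂ σ₃₄ b c : ℝ} {X : T1234Pt} (h : T1234Branch σ₁₂ σ₃₄ b c X) :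
    T1234Branch σ₁₂ (-σ₃₄) b c X.neg3 := by
  obtain ⟨h1, h2, h3, h4, h5, h6, h7, h8, h9, h10, h11⟩ := h
  simp only [T1234Branch, T1234Pt.neg3]
  exact ⟨by linear_combination h1, by linear_combination h2, by linear_combination h3,
    by linear_combination -h4, h5, h6, by linear_combination -h7, by linear_combination h9,
    by linear_combination h8, h10, by linear_combination h11⟩

/-- Solution sets. [folklore] -/
def t1234SliceSet (b c : ℝ) : Set T1234Pt := {X | X.Slice b c}
/-- Solution set of the branch system. [folklore] -/
def t1234BranchSet (σ₁₂ σ₃₄ b c : ℝ) : Set T1234Pt := {X | T1234Branch σ₁₂ σ₃₄ b c X}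

/-- Finiteness transfers along `neg1`. [folklore] -/
theorem t1234BranchSet_finite_neg1 {σ₁₂ σ₃₄ b c : ℝ} (h : (t1234BranchSet σ₁₂ σ₃₄ b c).Finite) :
    (t1234BranchSet (-σ₁₂) σ₃₄ b c).Finite := by
  refine (h.image T1234Pt.neg1).subset ?_
  intro X hX
  refine ⟨X.neg1, ?_, X.neg1_neg1⟩
  have := T1234Branch.neg1 (σ₁₂ := -σ₁₂) hX
  simpa [t1234BranchSet] using this

/-- Finiteness transfers along `neg3`. [folklore] -/
theorem t1234BranchSet_finite_neg3 {σ₁₂ σ₃₄ b c : ℝ} (h : (t1234BranchSet σ₁₂ σ₃₄ b c).Finite) :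
    (t1234BranchSet σ₁₂ (-σ₃₄) b c).Finite := by
  refine (h.image T1234Pt.neg3).subset ?_
  intro X hX
  refine ⟨X.neg3, ?_, X.neg3_neg3⟩
  have := T1234Branch.neg3 (σ₃₄ := -σ₃₄) hX
  simpa [t1234BranchSet] using this

/-- **One branch decides the `T1234` slice.** [folklore] -/
theorem t1234SliceSet_finite_iff_one (b c : ℝ) :
    (t1234SliceSet b c).Finite ↔ (t1234BranchSet 1 1 b c).Finite := by
  constructor
  · intro h
    refine h.subset ?_
    intro X hX
    exact (t1234Slice_iff_exists_branch b c X).2 ⟨1, 1, Or.inl rfl, Or.inl rfl, hX⟩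
  · intro hA
    have hB := t1234BranchSet_finite_neg3 hA
    have hC := t1234BranchSet_finite_neg1 hA
    have hD := t1234BranchSet_finite_neg1 hB
    have key : t1234SliceSet b c ⊆ t1234BranchSet 1 1 b c ∪ t1234BranchSet 1 (-1) b c ∪
        (t1234BranchSet (-1) 1 b c ∪ t1234BranchSet (-1) (-1) b c) := by
      intro X hX
      obtain ⟨σ₁₂, σ₃₄, s12, s34, hBr⟩ := (t1234Slice_iff_exists_branch b c X).1 hX
      rcases s12 with rfl | rfl <;> rcases s34 with rfl | rfl
      · exact Or.inl (Or.inl hBr)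
      · exact Or.inl (Or.inr hBr)
      · exact Or.inr (Or.inl hBr)
      · exact Or.inr (Or.inr hBr)
    exact ((hA.union hB).union (hC.union hD)).subset key

end Literature.Dynamics.NBody
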